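import Summits.ResolutionOfSingularities.ResolutionOfSingularities.Theorems.FrobeniusLadderFRationalResolutionSingBlowupCover
import Summits.ResolutionOfSingularities.ResolutionOfSingularities.Theorems.FrobeniusLadderFRationalResolutionConeNormalForm
import Summits.ResolutionOfSingularities.ResolutionOfSingularities.Theorems.FrobeniusLadderFRationalResolutionConeChartEntry
import HarnessLib

/-!
# Crux `FrobeniusLadder.FRationalResolution` (stmt-ResolutionOfSingularities-15317), line `redirect`,
# stub `stub_diagonalizableQuotientResolution` — **design C3 in the currency of the stub's charts: sharp rank-TWO
# outputs of `…IsolatedQuotientResolution.exists_sharp_affine_chart` at the singular points resolve `X`**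
# (the rank-2 stratum layer of the non-isolated case; plumbing from ring maps to étale roofs)

**`hasResolution_of_sharp_rank_two_charts`.** `X` integral, locally of finite type and quasi-compact over a field `k`.
Suppose every SINGULAR point `x` has: an étale `φₓ : Spec B → X` with `x = φₓ v` (the stub's `hq` gives
`B = 𝒮 0`), an étale ring map `ι : B → R` into a Noetherian ring and a prime `w` of `R` over `v`, and an fs chart
`χ : P → R` with `P ⊆ ℤ²` (RANK TWO), Kato-log-regular on a basic open `D(g) ∋ w`, all of whose non-trivial monomials lie
in `w` — exactly the output shape of `…IsolatedQuotientResolution.exists_sharp_affine_chart` with `n = 2`. Then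
`Scheme.HasResolution X`: the roof `X ←— Spec R_g —↪ Spec R` (étale = open immersion ≫ Spec ι ≫ φₓ) feeds
`…SingBlowupCover.hasResolution_of_rank_two_logRegular_charts_of_quasiCompact`, the normal form of `P` coming from
`…ConeNormalForm.exists_normalForm` (sharp by `…ConeChartEntry.sharp_of_face_zero`).

Honest label: plumbing toward ONE leaf stub (no stub, crux or summit closed). What separates this from the stub on the
rank-≤2 locus is only the hypothesis «`n = 2`» on the sharp chart at each singular point (automatic for surfaces,
`…ConeChartRank.rank_eq_two_of_not_isRegularLocalRing`; in dimension ≥ 3 it singles out the rank-2 strata — sharp rank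
≥ 3 needs torification). No definitions, no named facts, no sorry. [cite: Kato1994, Def. (2.1), (7.3), (10.1), (10.3)]
[cite: Fulton1993Toric, §2.2] [cite: Liu2002, §8.3.4, (3.11)]
-/

noncomputable section

-- single-problem summit: the doubled namespace component is forced
set_option linter.dupNamespace false

open CategoryTheory CategoryTheory.Limits AlgebraicGeometry TopologicalSpace
open IsLocalRing Literature.AlgebraicGeometry.Resolution Literature.AlgebraicGeometry.Resolution.LogChart
open Summit.ResolutionOfSingularities.ResolutionOfSingularities.Theorems.FRationalResolution

namespace Summit.ResolutionOfSingularities.ResolutionOfSingularities.Theorems.FRationalResolution.SingBlowupFromCharts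

set_option maxHeartbeats 800000 in
/-- **Sharp rank-two charts (in the output shape of `exists_sharp_affine_chart`) at the singular points resolve `X`.**
See the module docstring. [cite: Kato1994, Def. (2.1), (7.3), (10.1), (10.3)] [cite: Fulton1993Toric, §2.2] -/
theorem hasResolution_of_sharp_rank_two_charts {k : Type} [Field k] (X : Scheme.{0}) [IsIntegral X]
    (f : X ⟶ Spec (.of k)) [LocallyOfFiniteType f] [QuasiCompact f]
    (H : ∀ x : X, x ∉ Scheme.regularLocus X →
      ∃ (B : Type) (_ : CommRing B) (φₓ : Spec (.of B) ⟶ X) (_ : Etale φₓ) (v : Spec (.of B)), φₓ v = x ∧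
        ∃ (R : Type) (_ : CommRing R) (_ : IsNoetherianRing R) (ι : B →+* R), ι.Etale ∧
        ∃ (w : PrimeSpectrum R), w.asIdeal.comap ι = v.asIdeal ∧
        ∃ (P : AddSubmonoid (Fin 2 → ℤ)), P.FG ∧ (∀ (u : Fin 2 → ℤ) (K : ℕ), 0 < K → K • u ∈ P → u ∈ P) ∧
          Submodule.span ℤ (P : Set (Fin 2 → ℤ)) = ⊤ ∧
        ∃ (χ : Multiplicative P →* R) (g : R), g ∉ w.asIdeal ∧
          (∀ (𝔭 : Ideal R) [𝔭.IsPrime], g ∉ 𝔭 → IsLogRegularAt P χ 𝔭) ∧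
          (∀ p : P, (p : Fin 2 → ℤ) ≠ 0 → χ (Multiplicative.ofAdd p) ∈ w.asIdeal)) :
    Scheme.HasResolution X := by
  classical
  refine SingBlowupCover.hasResolution_of_rank_two_logRegular_charts_of_quasiCompact X f fun x hx => ?_
  obtain ⟨B, _, φₓ, _, v, hvx, R, _, _, ι, hι, w, hwv, P, hP, hsat, hspanP, χ, g, hgw, hreg, hface⟩ := H x hx
  -- the normal form of the sharp rank-two monoid
  obtain ⟨u, e, d, a, had, hind, hspan, hmem⟩ :=
    ConeNormalForm.exists_normalForm P hP hsat hspanP (ConeChartEntry.sharp_of_face_zero (𝔭 := w.asIdeal) hface)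
  have hL := ConeChartEntry.span_faceMonoid_eq_bot (P := P) (φ := χ) (𝔭 := w.asIdeal) hface
  -- the roof `X ←— Spec R_g —↪ Spec R`
  set l : Spec (.of (Localization.Away g)) ⟶ Spec (.of R) :=
    Spec.map (CommRingCat.ofHom (algebraMap R (Localization.Away g))) with hl
  haveI : Etale (Spec.map (CommRingCat.ofHom ι)) := (HasRingHomProperty.Spec_iff (P := @Etale)).mpr hι
  have hdisj : Disjoint (Submonoid.powers g : Set R) ↑w.asIdeal :=
    (Ideal.disjoint_powers_iff_notMem_of_isPrime (I := w.asIdeal) g).mpr hgw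
  haveI hprime : (w.asIdeal.map (algebraMap R (Localization.Away g))).IsPrime :=
    IsLocalization.isPrime_of_isPrime_disjoint (Submonoid.powers g) (Localization.Away g) w.asIdeal w.isPrime hdisj
  let y : Spec (.of (Localization.Away g)) := ⟨w.asIdeal.map (algebraMap R (Localization.Away g)), hprime⟩
  have hly : (l y).asIdeal = w.asIdeal := by
    show (w.asIdeal.map (algebraMap R (Localization.Away g))).comap (algebraMap R (Localization.Away g)) = w.asIdeal
    exact IsLocalization.under_map_of_isPrime_disjoint (Submonoid.powers g) (Localization.Away g) w.isPrime hdisj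
  have hlypt : l y = w := PrimeSpectrum.ext hly
  have hιw : Spec.map (CommRingCat.ofHom ι) w = v := by
    apply PrimeSpectrum.ext
    rw [← hwv]
    rfl
  refine ⟨R, inferInstance, inferInstance, P, χ, w.asIdeal, w.isPrime, u, e, a, d, had, hP, hsat, hspanP, hface,
    fun w' => ?_, fun g' hg' m' l' h => ?_, fun w' => ?_, Spec (.of (Localization.Away g)),
    l ≫ Spec.map (CommRingCat.ofHom ι) ≫ φₓ, inferInstance, l, inferInstance, y, ?_, hly, fun y' 𝔮 _ h𝔮 => ?_⟩
  · rw [hmem w']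
    constructor
    · rintro ⟨m, l', hl', hml, rfl⟩
      exact ⟨0, Submodule.zero_mem _, m, l', hl', hml, by rw [zero_add]⟩
    · rintro ⟨g', hg', m, l', hl', hml, rfl⟩
      exact ⟨m, l', hl', hml, by rw [hL g' hg', zero_add]⟩
  · rw [hL g' hg', zero_add] at h
    exact hind m' l' h
  · obtain ⟨m, l', rfl⟩ := hspan w'
    exact ⟨0, Submodule.zero_mem _, m, l', by rw [zero_add]⟩
  · rw [Scheme.Hom.comp_apply, Scheme.Hom.comp_apply, hlypt, hιw, hvx]
  · -- log regularity below any point of the roof: such primes avoid `g`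
    apply hreg 𝔮
    intro hg𝔮
    have h1 : g ∈ (l y').asIdeal := h𝔮 hg𝔮
    have h2 : algebraMap R (Localization.Away g) g ∈ y'.asIdeal := h1
    exact y'.isPrime.ne_top (Ideal.eq_top_of_isUnit_mem _ h2
      (IsLocalization.map_units (Localization.Away g) ⟨g, Submonoid.mem_powers g⟩))

end Summit.ResolutionOfSingularities.ResolutionOfSingularities.Theorems.FRationalResolution.SingBlowupFromCharts

end
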